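import Literature.Analysis.FluidPDE.CompressibleEulerImplosion
import Literature.Analysis.FluidPDE.IsentropicEulerFiniteSpeedOfPropagation
import Literature.Analysis.FunctionSpaces.TorusCalculusProofs
import Literature.Analysis.FunctionSpaces.TorusSpaceTime
import HarnessLib

/-!
# Uniqueness of classical solutions of the isentropic compressible Euler equations on `𝕋³`

Topic `Literature/Analysis/FluidPDE`; namespace `Literature.Analysis.FluidPDE`, auxiliary material in
the sub-namespace `IsentropicEuler`. Theorem-only file.

`CompressibleEulerImplosion.lean` fixes the tree's notion `IsIsentropicEulerSolution γ T ρ u` of a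
classical solution of the isentropic compressible Euler system `∂ₜρ + div(ρu) = 0`,
`ρ∂ₜu + ρ(u·∇)u + ∇(ρ^γ/γ) = 0` on `[0, T) × 𝕋³` (jointly `C^∞`, `ρ > 0`, one-sided time derivative
at `t = 0`), in which the implosion theorems of Cao-Labora–Gómez-Serrano–Shi–Staffilani are vendored.
This file proves that such solutions are **determined by their data**:

* `IsentropicEuler.uσ_equations` — in the variables `(u, σ = α⁻¹ρ^α)`, `α = (γ−1)/2`, the periodic
  lift of a classical solution solves the symmetric system `∂ₜσ + u·∇σ + ασ div u = 0`,
  `∂ₜu + (u·∇)u + ασ∇σ = 0` on `(0, T) × ℝ³` (Cao-Labora–Gómez-Serrano–Shi–Staffilani, §1.3, first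
  display);
* `IsentropicEuler.unique` — two classical solutions on `[0, T) × 𝕋³` (`γ > 1`) with the same data
  at `t = 0` coincide on `[0, T)`.

The second is the corollary, for periodic data, of the finite speed of propagation / local
uniqueness theorem `IsentropicEuler.eqOn_cone_of_eqOn_ball` of
`IsentropicEulerFiniteSpeedOfPropagation.lean` (Dafermos, *Hyperbolic Conservation Laws in Continuum
Physics*, 2nd ed. 2005, Thm 5.2.1, "in particular `Ū` is the unique … solution"): the lifts are `C¹` on
every slab `[0, t₁) × ℝ³`, `t₁ < T`, the characteristic speed `|u| + |ασ|` is bounded there by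
compactness of `[0, t₁] × 𝕋³`, and every point `(t, y)` is the tip of a backward acoustic cone of base
radius `ct + 1` on which the data agree.

## References

* C. M. Dafermos, *Hyperbolic Conservation Laws in Continuum Physics*, 2nd ed., Springer 2005, §5.2,
  Thm 5.2.1 (key `Dafermos2005`).
* G. Cao-Labora, J. Gómez-Serrano, J. Shi, G. Staffilani, arXiv:2310.05325, eq. (1.1) and §1.3
  (key `CaolaboraEtAl2025`).
-/

noncomputable section

open Set Filter MeasureTheory Metric
open scoped Topology ContDiff RealInnerProductSpace

namespace Literature.Analysis.FluidPDE

namespace IsentropicEuler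

open Literature.MathematicalPhysics.KineticTheory (T3 V3)
open Literature.Analysis.FunctionSpaces

/-! ### Torus derivatives through the periodic lift -/

section TorusLift

variable {F : Type*} [NormedAddCommGroup F] [NormedSpace ℝ F]

/-- `∂ᵢf(proj y) = D(lift f)(y) eᵢ` for `C¹` functions on the torus. [folklore] -/
theorem partialDeriv_proj_eq {f : T3 → F} (hf : Torus.IsContDiff 1 f) (i : Fin 3) (y : V3) :
    Torus.partialDeriv i f (Torus.proj y) =
      fderiv ℝ (Torus.lift f) y (EuclideanSpace.single i 1) := by
  rw [Torus.partialDeriv_eq_fderiv_apply hf, Torus.fderiv_lift]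

/-- `∇θ(proj y) = ∇(lift θ)(y)`: the torus gradient is Mathlib's gradient of the periodic lift.
[folklore] -/
theorem gradient_proj_eq (θ : T3 → ℝ) (y : V3) :
    Torus.gradient θ (Torus.proj y) = gradient (Torus.lift θ) y := by
  refine ext_inner_right ℝ fun w => ?_
  rw [Torus.inner_gradient_left, ← Torus.fderiv_lift, inner_gradient_eq_fderiv]

/-- In the interior of the time interval the one-sided time derivative is the derivative.
[folklore] -/
theorem timeDerivWithin_Ico_eq_deriv {T t : ℝ} (ht : t ∈ Ioo 0 T) (φ : ℝ → T3 → F) (x : T3) :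
    Torus.timeDerivWithin (Ico 0 T) φ t x = deriv (fun τ => φ τ x) t := by
  rw [Torus.timeDerivWithin_of_mem_interior (by rwa [interior_Ico]) x]
  rfl

/-- `∇(f^q/q)(y) = f(y)^{q−1} ∇f(y)` for `f > 0` differentiable, `q ≠ 0`. [folklore] -/
theorem gradient_rpow_div {f : V3 → ℝ} {y : V3} {q : ℝ} (hf : DifferentiableAt ℝ f y)
    (hy : f y ≠ 0) (hq : q ≠ 0) :
    gradient (fun z => f z ^ q / q) y = (f y ^ (q - 1)) • gradient f y := by
  have hd : HasFDerivAt (fun z => f z ^ q / q) (q⁻¹ • ((q * f y ^ (q - 1)) • fderiv ℝ f y)) y := by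
    have h := (hf.hasFDerivAt.rpow_const (p := q) (Or.inl hy)).const_mul q⁻¹
    refine h.congr_of_eventuallyEq (Filter.Eventually.of_forall fun z => ?_)
    show f z ^ q / q = q⁻¹ * f z ^ q
    ring
  refine ext_inner_right ℝ fun w => ?_
  rw [inner_gradient_eq_fderiv, hd.fderiv, real_inner_smul_left, inner_gradient_eq_fderiv]
  simp only [smul_apply, smul_eq_mul]
  field_simp

/-- `∇(a f^q)(y) = a q f(y)^{q−1} ∇f(y)` for `f > 0` differentiable. [folklore] -/
theorem gradient_const_mul_rpow {f : V3 → ℝ} {y : V3} {a q : ℝ} (hf : DifferentiableAt ℝ f y)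
    (hy : f y ≠ 0) :
    gradient (fun z => a * f z ^ q) y = (a * q * f y ^ (q - 1)) • gradient f y := by
  have hd : HasFDerivAt (fun z => a * f z ^ q) (a • ((q * f y ^ (q - 1)) • fderiv ℝ f y)) y :=
    (hf.hasFDerivAt.rpow_const (p := q) (Or.inl hy)).const_mul a
  refine ext_inner_right ℝ fun w => ?_
  rw [inner_gradient_eq_fderiv, hd.fderiv, real_inner_smul_left, inner_gradient_eq_fderiv]
  simp only [smul_apply, smul_eq_mul]
  ring

end TorusLift

/-! ### The `(u, σ)`-system for the periodic lift of a classical solution -/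

section Lift

variable {γ T : ℝ} {ρ : ℝ → T3 → ℝ} {u : ℝ → T3 → V3}

/-- The lifted velocity of a classical solution is `C¹` on every slab `[0, t₁) × ℝ³`, `t₁ ≤ T`.
[folklore] -/
theorem contDiffOn_lift_velocity (h : IsIsentropicEulerSolution γ T ρ u) {t₁ : ℝ} (ht₁ : t₁ ≤ T) :
    ContDiffOn ℝ 1 (fun p : ℝ × V3 => u p.1 (Torus.proj p.2)) (Ico 0 t₁ ×ˢ univ) :=
  (h.smooth_velocity.of_le (by norm_cast)).mono (prod_mono (Ico_subset_Ico_right ht₁) le_rfl)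

/-- The lifted density of a classical solution is `C¹` on every slab `[0, t₁) × ℝ³`, `t₁ ≤ T`.
[folklore] -/
theorem contDiffOn_lift_density (h : IsIsentropicEulerSolution γ T ρ u) {t₁ : ℝ} (ht₁ : t₁ ≤ T) :
    ContDiffOn ℝ 1 (fun p : ℝ × V3 => ρ p.1 (Torus.proj p.2)) (Ico 0 t₁ ×ˢ univ) :=
  (h.smooth_density.of_le (by norm_cast)).mono (prod_mono (Ico_subset_Ico_right ht₁) le_rfl)

/-- The lifted rescaled sound speed `σ = α⁻¹ρ^α` of a classical solution is `C¹` on every slab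
`[0, t₁) × ℝ³`, `t₁ ≤ T` (`ρ > 0`). [folklore] -/
theorem contDiffOn_lift_soundSpeed (h : IsIsentropicEulerSolution γ T ρ u) (α : ℝ) {t₁ : ℝ}
    (ht₁ : t₁ ≤ T) :
    ContDiffOn ℝ 1 (fun p : ℝ × V3 => α⁻¹ * ρ p.1 (Torus.proj p.2) ^ α) (Ico 0 t₁ ×ˢ univ) := by
  refine contDiffOn_const.mul ((contDiffOn_lift_density h ht₁).rpow_const_of_ne fun p hp => ?_)
  exact (h.density_pos p.1 ⟨hp.1.1, hp.1.2.trans_le ht₁⟩ _).ne'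

/-- **The `(u, σ)`-system for the lift of a classical solution** (Cao-Labora–Gómez-Serrano–Shi–
Staffilani, §1.3, first display, derived from eq. (1.1) with `ν = 0`): with `α = (γ−1)/2`,
`σ = α⁻¹ρ^α`, `U(t, y) = u(t, proj y)`, `Σ(t, y) = σ(t, proj y)`, for `0 < t < T` and `y ∈ ℝ³`,
`∂ₜΣ + DΣ(U) + αΣ div U = 0` and `∂ₜU + DU(U) + αΣ ∇Σ = 0`. Proof: the mass equation gives
`∂ₜρ + Dρ(u) + ρ div u = 0` and `∂σ = ρ^{α−1}∂ρ`; the momentum equation divided by `ρ` gives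
`∂ₜu + Du(u) + ρ^{γ−2}∇ρ = 0` and `ασ∇σ = ρ^{2α−1}∇ρ = ρ^{γ−2}∇ρ`.
[cite: CaolaboraEtAl2025, §1.3 first display and eq. (1.1) (ν = 0)] -/
theorem uσ_equations (h : IsIsentropicEulerSolution γ T ρ u) (hγ : 1 < γ) {t : ℝ} (ht : t ∈ Ioo 0 T)
    (y : V3) :
    (deriv (fun s => ((γ - 1) / 2)⁻¹ * ρ s (Torus.proj y) ^ ((γ - 1) / 2)) t +
        fderiv ℝ (fun z => ((γ - 1) / 2)⁻¹ * ρ t (Torus.proj z) ^ ((γ - 1) / 2)) y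
          (u t (Torus.proj y)) +
        (γ - 1) / 2 * (((γ - 1) / 2)⁻¹ * ρ t (Torus.proj y) ^ ((γ - 1) / 2)) *
          ∑ i, fderiv ℝ (fun z => u t (Torus.proj z)) y (EuclideanSpace.single i 1) i = 0) ∧
      deriv (fun s => u s (Torus.proj y)) t +
          fderiv ℝ (fun z => u t (Torus.proj z)) y (u t (Torus.proj y)) +
        ((γ - 1) / 2 * (((γ - 1) / 2)⁻¹ * ρ t (Torus.proj y) ^ ((γ - 1) / 2))) •
          gradient (fun z => ((γ - 1) / 2)⁻¹ * ρ t (Torus.proj z) ^ ((γ - 1) / 2)) y = 0 := by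
  -- notation
  set α : ℝ := (γ - 1) / 2 with hα
  have hα0 : α ≠ 0 := by rw [hα]; intro h0; linarith
  have hγ0 : γ ≠ 0 := by intro h0; linarith
  set P : ℝ → V3 → ℝ := fun s z => ρ s (Torus.proj z) with hP
  set U : ℝ → V3 → V3 := fun s z => u s (Torus.proj z) with hU
  have htI : t ∈ Ico 0 T := ⟨ht.1.le, ht.2⟩
  have hp : 0 < P t y := h.density_pos t htI _
  -- regularity of the lifts and of the slices
  have hPst : ContDiffOn ℝ 1 (fun p : ℝ × V3 => P p.1 p.2) (Ico 0 T ×ˢ univ) :=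
    contDiffOn_lift_density h le_rfl
  have hUst : ContDiffOn ℝ 1 (fun p : ℝ × V3 => U p.1 p.2) (Ico 0 T ×ˢ univ) :=
    contDiffOn_lift_velocity h le_rfl
  have hPs : ContDiff ℝ 1 (P t) := contDiff_space hPst ht
  have hUs : ContDiff ℝ 1 (U t) := contDiff_space hUst ht
  have hPt : HasDerivAt (fun τ => P τ y) (deriv (fun τ => P τ y) t) t :=
    (hasDerivAt_time hPst ht y).differentiableAt.hasDerivAt
  have hUt : HasDerivAt (fun τ => U τ y) (deriv (fun τ => U τ y) t) t :=
    (hasDerivAt_time hUst ht y).differentiableAt.hasDerivAt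
  have hPx : HasFDerivAt (P t) (fderiv ℝ (P t) y) y :=
    ((hPs.differentiable one_ne_zero) y).hasFDerivAt
  have hUx : HasFDerivAt (U t) (fderiv ℝ (U t) y) y :=
    ((hUs.differentiable one_ne_zero) y).hasFDerivAt
  have hρ1 : Torus.IsContDiff 1 (ρ t) := hPs
  have hu1 : Torus.IsContDiff 1 (u t) := hUs
  -- abbreviations for the values and derivatives at `(t, y)`
  set p : ℝ := P t y with hpdef
  set pt : ℝ := deriv (fun τ => P τ y) t with hptdef
  set Lp : V3 →L[ℝ] ℝ := fderiv ℝ (P t) y with hLp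
  set a : V3 := U t y with hadef
  set at' : V3 := deriv (fun τ => U τ y) t with hatdef
  set A : V3 →L[ℝ] V3 := fderiv ℝ (U t) y with hA
  set g : V3 := gradient (P t) y with hg
  -- ### the mass equation: `pt + Lp a + p tr A = 0`
  have hmass : pt + (Lp a + p * ∑ i, A (EuclideanSpace.single i 1) i) = 0 := by
    have hm := h.mass t htI (Torus.proj y)
    rw [timeDerivWithin_Ico_eq_deriv ht] at hm
    have hdiv : Torus.divergence (fun x => ρ t x • u t x) (Torus.proj y) =
        Lp a + p * ∑ i, A (EuclideanSpace.single i 1) i := by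
      simp only [Torus.divergence]
      have hcomp : ∀ i, HasFDerivAt (fun z => U t z i)
          (PiLp.proj 2 (fun _ : Fin 3 => ℝ) i ∘L A) y := fun i => by
        have h' := hUx
        rw [← hasFDerivWithinAt_univ, hasFDerivWithinAt_euclidean] at h'
        exact hasFDerivWithinAt_univ.1 (h' i)
      have hci : ∀ i, Torus.IsContDiff 1 (fun x => (ρ t x • u t x) i) := fun i => by
        change ContDiff ℝ 1 (fun z => (P t z • U t z) i)
        exact contDiff_euclidean.1 (hPs.smul hUs) i
      have hterm : ∀ i, Torus.partialDeriv i (fun x => (ρ t x • u t x) i) (Torus.proj y) =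
          p * A (EuclideanSpace.single i 1) i + a i * Lp (EuclideanSpace.single i 1) := by
        intro i
        rw [partialDeriv_proj_eq (hci i)]
        have hfun : Torus.lift (fun x => (ρ t x • u t x) i) = fun z => P t z * U t z i := by
          funext z
          simp [Torus.lift_apply, hP, hU]
        have hprod : HasFDerivAt (fun z => P t z * U t z i)
            (P t y • (PiLp.proj 2 (fun _ : Fin 3 => ℝ) i ∘L A) + U t y i • Lp) y :=
          hPx.mul (hcomp i)
        rw [hfun, hprod.fderiv]
        simp only [add_apply, smul_apply, ContinuousLinearMap.coe_comp, Function.comp_apply,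
          PiLp.proj_apply, smul_eq_mul]
        rfl
      simp only [hterm, Finset.sum_add_distrib, ← Finset.mul_sum]
      rw [clm_apply_eq_sum Lp a]
      simp only [smul_eq_mul]
      ring
    rw [hdiv] at hm
    exact hm
  -- ### the momentum equation: `p • at + p • A a + p^{γ−1} • g = 0`
  have hmom : p • at' + p • A a + (p ^ (γ - 1)) • g = 0 := by
    have hm := h.momentum t htI (Torus.proj y)
    rw [timeDerivWithin_Ico_eq_deriv ht] at hm
    have hconv : ∑ i, u t (Torus.proj y) i • Torus.partialDeriv i (u t) (Torus.proj y) = A a := by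
      simp only [partialDeriv_proj_eq hu1]
      exact (clm_apply_eq_sum A a).symm
    have hgrad : Torus.gradient (fun x => ρ t x ^ γ / γ) (Torus.proj y) = (p ^ (γ - 1)) • g := by
      rw [gradient_proj_eq]
      change gradient (fun z => P t z ^ γ / γ) y = (p ^ (γ - 1)) • g
      exact gradient_rpow_div (hPx.differentiableAt) hp.ne' hγ0
    rw [hconv, hgrad] at hm
    exact hm
  -- ### derivatives of `Σ = α⁻¹ P^α`
  have hSt : deriv (fun s => α⁻¹ * P s y ^ α) t = p ^ (α - 1) * pt := by
    rw [((hPt.rpow_const (p := α) (Or.inl hp.ne')).const_mul α⁻¹).deriv]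
    field_simp
    rfl
  have hSx : fderiv ℝ (fun z => α⁻¹ * P t z ^ α) y a = p ^ (α - 1) * Lp a := by
    rw [((hPx.rpow_const (p := α) (Or.inl hp.ne')).const_mul α⁻¹).fderiv]
    simp only [smul_apply, smul_eq_mul]
    field_simp
    exact mul_comm _ _
  have hSg : gradient (fun z => α⁻¹ * P t z ^ α) y = (p ^ (α - 1)) • g := by
    rw [gradient_const_mul_rpow hPx.differentiableAt hp.ne']
    congr 1
    field_simp
    rfl
  -- ### power identities
  have hpow1 : p ^ (α - 1) * p = p ^ α := by
    rw [Real.rpow_sub_one hp.ne']; field_simp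
  have hpow2 : p * (α * (α⁻¹ * p ^ α) * p ^ (α - 1)) = p ^ (γ - 1) := by
    have h1 : α * (α⁻¹ * p ^ α) = p ^ α := by field_simp
    rw [h1]
    calc p * (p ^ α * p ^ (α - 1)) = p ^ (1 : ℝ) * (p ^ α * p ^ (α - 1)) := by rw [Real.rpow_one]
      _ = p ^ ((1 : ℝ) + (α + (α - 1))) := by rw [Real.rpow_add hp, Real.rpow_add hp]
      _ = p ^ (γ - 1) := by congr 1; rw [hα]; ring
  refine ⟨?_, ?_⟩
  · -- the `σ`-equation
    rw [hSt, hSx]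
    have key : p ^ (α - 1) * pt + p ^ (α - 1) * Lp a +
        α * (α⁻¹ * p ^ α) * ∑ i, A (EuclideanSpace.single i 1) i =
        p ^ (α - 1) * (pt + (Lp a + p * ∑ i, A (EuclideanSpace.single i 1) i)) := by
      rw [← hpow1]; field_simp; ring
    rw [key, hmass, mul_zero]
  · -- the `u`-equation
    rw [hSg, smul_smul]
    have key : p • (at' + A a + (α * (α⁻¹ * p ^ α) * p ^ (α - 1)) • g) = 0 := by
      rw [smul_add, smul_add, smul_smul, hpow2]
      exact hmom
    rcases smul_eq_zero.1 key with h0 | h0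
    · exact absurd h0 hp.ne'
    · exact h0

/-- **Boundedness of the characteristic speed.** For a classical solution on `[0, T) × 𝕋³` and
`t₁ < T` there is `c ≥ 0` with `|u| + |ασ| ≤ c` on `[0, t₁] × 𝕋³`, `σ = α⁻¹ρ^α`, `α > 0`
(continuity on a compact set). [folklore] -/
theorem exists_speed_bound (h : IsIsentropicEulerSolution γ T ρ u) {α : ℝ} (hα : 0 < α) {t₁ : ℝ}
    (ht₁ : t₁ < T) :
    ∃ c : ℝ, 0 ≤ c ∧ ∀ t ∈ Icc 0 t₁, ∀ x, ‖u t x‖ + |α * (α⁻¹ * ρ t x ^ α)| ≤ c := by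
  obtain ⟨Cu, hCu⟩ := h.smooth_velocity.exists_norm_le_of_isCompact isCompact_Icc
    (Icc_subset_Ico_right ht₁)
  obtain ⟨Cρ, hCρ⟩ := h.smooth_density.exists_norm_le_of_isCompact isCompact_Icc
    (Icc_subset_Ico_right ht₁)
  refine ⟨max Cu 0 + max Cρ 0 ^ α, by positivity, fun t ht x => add_le_add
    ((hCu t ht x).trans (le_max_left _ _)) ?_⟩
  have hρ0 : 0 < ρ t x := h.density_pos t ⟨ht.1, ht.2.trans_lt ht₁⟩ x
  have h1 : α * (α⁻¹ * ρ t x ^ α) = ρ t x ^ α := by field_simp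
  rw [h1, abs_of_nonneg (Real.rpow_nonneg hρ0.le _)]
  refine Real.rpow_le_rpow hρ0.le ?_ hα.le
  exact ((le_abs_self _).trans ((Real.norm_eq_abs _).symm.le.trans (hCρ t ht x))).trans
    (le_max_left _ _)

end Lift

/-! ### Uniqueness -/

section Unique

/-- **Uniqueness of classical solutions of the isentropic compressible Euler equations on `𝕋³`.**
Two classical solutions `(ρ₁, u₁)`, `(ρ₂, u₂)` of `∂ₜρ + div(ρu) = 0`,
`ρ∂ₜu + ρ(u·∇)u + ∇(ρ^γ/γ) = 0` (`γ > 1`) on `[0, T) × 𝕋³`, in the sense of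
`IsIsentropicEulerSolution γ T`, with the same data `ρ₁(0) = ρ₂(0)`, `u₁(0) = u₂(0)`, coincide on
`[0, T)`. This is the periodic-data corollary of the local uniqueness theorem in acoustic cones
(Dafermos, *Hyperbolic Conservation Laws in Continuum Physics*, 2nd ed. 2005, Thm 5.2.1, "in
particular `Ū` is the unique … solution"; here `IsentropicEuler.eqOn_cone_of_eqOn_ball` applied to
the periodic lifts in the variables `(u, σ = α⁻¹ρ^α)`, with the characteristic speed bounded on
`[0, t₁] × 𝕋³` by compactness). [cite: Dafermos2005, §5.2, Thm 5.2.1]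
[cite: CaolaboraEtAl2025, eq. (1.1) (ν = 0) and §1.3 first display] -/
theorem unique {γ T : ℝ} {ρ₁ ρ₂ : ℝ → T3 → ℝ} {u₁ u₂ : ℝ → T3 → V3} (hγ : 1 < γ)
    (h₁ : IsIsentropicEulerSolution γ T ρ₁ u₁) (h₂ : IsIsentropicEulerSolution γ T ρ₂ u₂)
    (hρ0 : ρ₁ 0 = ρ₂ 0) (hu0 : u₁ 0 = u₂ 0) {t : ℝ} (ht : t ∈ Ico 0 T) :
    ρ₁ t = ρ₂ t ∧ u₁ t = u₂ t := by
  set α : ℝ := (γ - 1) / 2 with hα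
  have hα0 : 0 < α := by rw [hα]; linarith
  -- a slab `[0, t₁)` with `t < t₁ < T`
  set t₁ : ℝ := (t + T) / 2 with ht₁def
  have htt₁ : t < t₁ := by rw [ht₁def]; linarith [ht.2]
  have ht₁T : t₁ < T := by rw [ht₁def]; linarith [ht.2]
  have htI : t ∈ Ico 0 t₁ := ⟨ht.1, htt₁⟩
  -- the speed bound for the first solution
  obtain ⟨c, hc0, hc⟩ := exists_speed_bound h₁ hα0 ht₁T
  -- pointwise equality of the lifts at `(t, y)` for every `y`
  have key : ∀ y : V3, u₁ t (Torus.proj y) = u₂ t (Torus.proj y) ∧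
      α⁻¹ * ρ₁ t (Torus.proj y) ^ α = α⁻¹ * ρ₂ t (Torus.proj y) ^ α := by
    intro y
    refine eqOn_cone_of_eqOn_ball (ι := Fin 3) (α := α) (c := c) (R := c * t + 1) (x₀ := y)
      (u₁ := fun s z => u₁ s (Torus.proj z)) (u₂ := fun s z => u₂ s (Torus.proj z))
      (σ₁ := fun s z => α⁻¹ * ρ₁ s (Torus.proj z) ^ α)
      (σ₂ := fun s z => α⁻¹ * ρ₂ s (Torus.proj z) ^ α)
      (contDiffOn_lift_velocity h₁ ht₁T.le) (contDiffOn_lift_velocity h₂ ht₁T.le)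
      (contDiffOn_lift_soundSpeed h₁ α ht₁T.le) (contDiffOn_lift_soundSpeed h₂ α ht₁T.le)
      (fun s hs z _ => ?_) (fun s hs z _ => ?_) (fun s hs z _ => hc s ⟨hs.1.le, hs.2.le⟩ _) hc0
      (fun z _ => ⟨by rw [hu0], by rw [hρ0]⟩) htI (by simp)
    · exact uσ_equations h₁ hγ ⟨hs.1, hs.2.trans ht₁T⟩ z
    · exact uσ_equations h₂ hγ ⟨hs.1, hs.2.trans ht₁T⟩ z
  refine ⟨funext fun x => ?_, funext fun x => ?_⟩
  · obtain ⟨y, rfl⟩ := Torus.proj_surjective x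
    have h := (key y).2
    have h1 : ρ₁ t (Torus.proj y) ^ α = ρ₂ t (Torus.proj y) ^ α := by
      have := congrArg (fun r => α * r) h
      simpa [hα0.ne'] using this
    have hp₁ : 0 < ρ₁ t (Torus.proj y) := h₁.density_pos t ht _
    have hp₂ : 0 < ρ₂ t (Torus.proj y) := h₂.density_pos t ht _
    calc ρ₁ t (Torus.proj y) = (ρ₁ t (Torus.proj y) ^ α) ^ α⁻¹ :=
          (Real.rpow_rpow_inv hp₁.le hα0.ne').symm
      _ = (ρ₂ t (Torus.proj y) ^ α) ^ α⁻¹ := by rw [h1]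
      _ = ρ₂ t (Torus.proj y) := Real.rpow_rpow_inv hp₂.le hα0.ne'
  · obtain ⟨y, rfl⟩ := Torus.proj_surjective x
    exact (key y).1

end Unique

end IsentropicEuler

end Literature.Analysis.FluidPDE
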